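import Mathlib
import Literature.AlgebraicGeometry.Resolution.CobordantGame
import Literature.AlgebraicGeometry.Resolution.EmbeddedResolutionExcellentSurfaces

/-!
# Typed proposal (third lead, line hasse-ridge-face-selection): the `n = 3` case of `stub_higherStartsWon`
# as a CONDITIONAL support item on the tree's named fact `CossartJannsenSaito2020Embedded`

Not a proof — a statement that elaborates, for the planner who re-lines the crux `LocalWeightedDrop`
(stmt-ResolutionOfSingularities-8899).  See Cruxes/LocalWeightedDrop/Lines/hasse-ridge-face-selection.md.
-/

set_option linter.dupNamespace false

namespace Summit.ResolutionOfSingularities.ResolutionOfSingularities.Theorems.FaceSelectionLine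

open Literature.AlgebraicGeometry.Resolution

/-- PROPOSED CONDITIONAL ITEM (n = 3): canonical embedded resolution of excellent surfaces (CJS, LNM 2270,
Thm 1.4 — the tree's named fact `CossartJannsenSaito2020Embedded`, here at universe `0`) implies that every
singular SURFACE germ `f ∈ k[[x,y,z]]` over an algebraically closed field of prime characteristic is in the
winning region of the local weighted resolution game.  Paper proof: follow the CJS blow-up sequence of
`V(f_red) ⊂ Spec k[[x,y,z]]` along the branch of closed points the Refuter chooses (regular centres through the
point = legal weight-0/1 moves after a formal coordinate change; weight-1 points are tame, so successors are
cylinders over the classical chart germs; skip blow-ups whose centre misses the point); at the end the position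
is a unit times a monomial (`stub_monomialWon`, landed p113582); a history-dependent well-founded strategy
gives `Won` by induction on the strategy tree.  Formal cost: the dictionary "blow-up of `Spec k[[x]]` in a
regular centre, completed at a closed exceptional point = cobordant chart substitution" over the tree's
`Blowup*` / `IsEmbeddedTransform` library. -/
theorem surfaceStartsWon_of_CJS (hCJS : CossartJannsenSaito2020Embedded.{0}) :
    ∀ (p : ℕ), p.Prime → ∀ (k : Type) [Field k] [CharP k p] [IsAlgClosed k] (f : MvPowerSeries (Fin 3) k),
      CobordantGame.IsSingular k f → CobordantGame.Won k 3 f := by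
  sorry

end Summit.ResolutionOfSingularities.ResolutionOfSingularities.Theorems.FaceSelectionLine
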